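import Mathlib
import Literature.Geometry.DiscreteGeometry.KissingFanTriangleSets
import Summits.AtomisticToContinuum.Crystallization.Theorems.GappedShellCensusFiveFoldRationingRStubFfrCensus5Aux1

/-!
# Crux `GappedShellCensus.FiveFoldRationingR` (stmt-AtomisticToContinuum-18071), line `Sketch` —
# helper for stub `stub_ffrC5Cert` (registered sub-goal `stub_ffrC5CertFacesOf`): the face
# condition (C2) of the capped census from a coordinate-level facet exclusion

Conjunct (C2) of the certificate stub `stub_ffrC5Cert` says that every fan triangle of the radial
hull of a gapped twelve-tuple `t : Fin 12 → ℝ³` has a vertex bonded (`≤ 1.02`) to its two other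
vertices.  This file is the DICTIONARY HALF of (C2): it removes the fan machinery from the statement.
If no three distinct labels `p, q, r` with `pq` and `pr` FAR (`≥ 1.26`) admit a supporting functional
of the normalised shell through them — a vector `c` with `⟪c, u p⟫ = ⟪c, u q⟫ = ⟪c, u r⟫ = 1` and
`⟪c, u l⟫ ≤ 1` for every label `l`, where `u k = t k / ‖t k‖` — then (C2) holds.  The hypothesis is a
statement about coordinates and one linear functional only (the shape a box-search certificate with a
facet leaf refutes); the conclusion is (C2) verbatim.

## Proof

A fan triangle `S ∈ tri` has three vertices (`card_eq_three_of_mem_fanTriSets`; the normalisation is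
injective, `ffrC5_normalize_injective`), say `S = {p, q, r}`, and lies on a facet of the hull of the
unit vectors `X = {u k}` (`exists_subset_tightSet_of_mem_fanTriSets`): its facet normal `c` has
`⟪c, ·⟫ = 1` on the three vertices and `≤ 1` on `X` (`IsFacetNormal`).  If no vertex of `S` were
bonded to both others, every vertex would have a far partner in `S` (each pair is a bond or far), and
among three vertices each carrying a far side some vertex carries two (two sides of a triangle always
share a vertex) — contradicting the hypothesis at that vertex.
-/

noncomputable section

namespace Summit.AtomisticToContinuum.Crystallization.Theorems

open scoped RealInnerProductSpace
open Literature.Geometry.DiscreteGeometry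

/-- **Sub-stub `stub_ffrC5CertFacesOf` (dictionary half of (C2)).**  For a gapped twelve-tuple: if no
three distinct labels `p, q, r` with `pq`, `pr` far carry a supporting functional `c` of the normalised
shell (`⟪c, u p⟫ = ⟪c, u q⟫ = ⟪c, u r⟫ = 1`, `⟪c, u l⟫ ≤ 1` for all `l`), then every fan triangle of
the radial hull has a vertex bonded to its two other vertices. [folklore] -/
theorem stub_ffrC5CertFacesOf (t : Fin 12 → EuclideanSpace ℝ (Fin 3))
    (hn : ∀ k, 1 - 1 / 50 ≤ ‖t k‖ ∧ ‖t k‖ ≤ 1 + 1 / 50)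
    (hd : ∀ k l, k ≠ l → 1 - 1 / 50 ≤ dist (t k) (t l) ∧ (dist (t k) (t l) ≤ 1 + 1 / 50 ∨ 63 / 50 ≤ dist (t k) (t l)))
    (H : ∀ p q r : Fin 12, p ≠ q → p ≠ r → q ≠ r →
      63 / 50 ≤ dist (t p) (t q) → 63 / 50 ≤ dist (t p) (t r) →
      (∃ c : EuclideanSpace ℝ (Fin 3), inner ℝ c (‖t p‖⁻¹ • t p) = 1 ∧ inner ℝ c (‖t q‖⁻¹ • t q) = 1 ∧
        inner ℝ c (‖t r‖⁻¹ • t r) = 1 ∧ ∀ l, inner ℝ c (‖t l‖⁻¹ • t l) ≤ 1) → False) :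
    ∀ S ∈ (Finset.univ.powerset.filter fun S : Finset (Fin 12) =>
        S.image (fun k => ‖t k‖⁻¹ • t k) ∈
          Literature.Geometry.DiscreteGeometry.fanTriSets (Finset.univ.image fun k => ‖t k‖⁻¹ • t k)),
      ∃ a ∈ S, ∀ b ∈ S, b ≠ a → dist (t a) (t b) ≤ 1 + 1 / 50 := by
  intro S hS
  set u : Fin 12 → EuclideanSpace ℝ (Fin 3) := fun k => ‖t k‖⁻¹ • t k with hu
  set X : Finset (EuclideanSpace ℝ (Fin 3)) := Finset.univ.image u with hX
  have hX1 : ∀ y ∈ X, ‖y‖ = 1 := by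
    intro y hy
    obtain ⟨k, -, rfl⟩ := Finset.mem_image.1 hy
    exact ffrC5_norm_normalize (hn k)
  have hinj : Function.Injective u := ffrC5_normalize_injective t hn hd
  have hS' : S.image u ∈ fanTriSets X := (Finset.mem_filter.1 hS).2
  have hcard : S.card = 3 := by
    rw [← Finset.card_image_of_injective S hinj]
    exact card_eq_three_of_mem_fanTriSets hX1 hS'
  obtain ⟨p, q, r, hpq, hpr, hqr, rfl⟩ := Finset.card_eq_three.1 hcard
  -- the supporting functional of the facet carrying `S`
  obtain ⟨c, hc, hsub⟩ := exists_subset_tightSet_of_mem_fanTriSets hX1 hS'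
  have hcX : ∀ l, ⟪c, u l⟫ ≤ 1 := fun l =>
    (mem_facetNormals.1 hc).1 (u l) (Finset.mem_image_of_mem u (Finset.mem_univ l))
  have htight : ∀ a ∈ ({p, q, r} : Finset (Fin 12)), ⟪c, u a⟫ = 1 := fun a ha =>
    (mem_tightSet.1 (hsub (Finset.mem_image_of_mem u ha))).2
  -- the hypothesis at an apex `a` with two far sides `ab`, `ad` inside `S`
  have key : ∀ a b d : Fin 12, a ≠ b → a ≠ d → b ≠ d →
      a ∈ ({p, q, r} : Finset (Fin 12)) → b ∈ ({p, q, r} : Finset (Fin 12)) →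
      d ∈ ({p, q, r} : Finset (Fin 12)) →
      63 / 50 ≤ dist (t a) (t b) → 63 / 50 ≤ dist (t a) (t d) → False :=
    fun a b d hab had hbd ha hb hd' h1 h2 =>
      H a b d hab had hbd h1 h2 ⟨c, htight a ha, htight b hb, htight d hd', hcX⟩
  -- every pair is a bond or far
  have far_of_lt : ∀ a b : Fin 12, a ≠ b → 1 + 1 / 50 < dist (t a) (t b) →
      63 / 50 ≤ dist (t a) (t b) := fun a b hab hlt =>
    ((hd a b hab).2).resolve_left (not_le.2 hlt)
  have far_symm : ∀ a b : Fin 12, 63 / 50 ≤ dist (t a) (t b) → 63 / 50 ≤ dist (t b) (t a) :=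
    fun a b h => by rwa [dist_comm] at h
  by_contra hneg
  push Not at hneg
  have hp : p ∈ ({p, q, r} : Finset (Fin 12)) := by simp
  have hq : q ∈ ({p, q, r} : Finset (Fin 12)) := by simp
  have hr : r ∈ ({p, q, r} : Finset (Fin 12)) := by simp
  -- each vertex has a far partner inside `S`
  have farP : 63 / 50 ≤ dist (t p) (t q) ∨ 63 / 50 ≤ dist (t p) (t r) := by
    obtain ⟨b, hb, hbp, hlt⟩ := hneg p hp
    simp only [Finset.mem_insert, Finset.mem_singleton] at hb
    rcases hb with rfl | rfl | rfl
    · exact absurd rfl hbp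
    · exact Or.inl (far_of_lt _ _ hpq hlt)
    · exact Or.inr (far_of_lt _ _ hpr hlt)
  have farQ : 63 / 50 ≤ dist (t q) (t p) ∨ 63 / 50 ≤ dist (t q) (t r) := by
    obtain ⟨b, hb, hbq, hlt⟩ := hneg q hq
    simp only [Finset.mem_insert, Finset.mem_singleton] at hb
    rcases hb with rfl | rfl | rfl
    · exact Or.inl (far_of_lt _ _ (Ne.symm hpq) hlt)
    · exact absurd rfl hbq
    · exact Or.inr (far_of_lt _ _ hqr hlt)
  have farR : 63 / 50 ≤ dist (t r) (t p) ∨ 63 / 50 ≤ dist (t r) (t q) := by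
    obtain ⟨b, hb, hbr, hlt⟩ := hneg r hr
    simp only [Finset.mem_insert, Finset.mem_singleton] at hb
    rcases hb with rfl | rfl | rfl
    · exact Or.inl (far_of_lt _ _ (Ne.symm hpr) hlt)
    · exact Or.inr (far_of_lt _ _ (Ne.symm hqr) hlt)
    · exact absurd rfl hbr
  -- among three vertices each carrying a far side, one carries two
  rcases farP with hPQ | hPR
  · rcases farQ with hQP | hQR
    · rcases farR with hRP | hRQ
      · exact key p q r hpq hpr hqr hp hq hr hPQ (far_symm _ _ hRP)
      · exact key q p r (Ne.symm hpq) hqr hpr hq hp hr hQP (far_symm _ _ hRQ)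
    · exact key q p r (Ne.symm hpq) hqr hpr hq hp hr (far_symm _ _ hPQ) hQR
  · rcases farR with hRP | hRQ
    · rcases farQ with hQP | hQR
      · exact key p q r hpq hpr hqr hp hq hr (far_symm _ _ hQP) hPR
      · exact key r p q (Ne.symm hpr) (Ne.symm hqr) hpq hr hp hq hRP (far_symm _ _ hQR)
    · exact key r p q (Ne.symm hpr) (Ne.symm hqr) hpq hr hp hq (far_symm _ _ hPR) hRQ

end Summit.AtomisticToContinuum.Crystallization.Theorems

end
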